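import Summits.BirchSwinnertonDyer.BirchSwinnertonDyer.Theorems.ManinLocalTwoThreeStevensCurveConsumers
import Summits.BirchSwinnertonDyer.BirchSwinnertonDyer.Theorems.ManinLocalTwoThreeManinConstantOfStevensInclusion
import HarnessLib

/-!
# CES eliminated from the rung: `2 ∣ c₀ ⟹ 2⁵ ∣ N`, Abbes–Ullmo / Česnavičius and `ManinConstantOne` modulo {modularity, CDT, T-es-75}
(route `ManinLocalTwoThree`, rung stmt-BirchSwinnertonDyer-22445, support items stmt-…-20090 / 20091, crux C2 stmt-…-22967; cell bsd-f2-manin, prover p3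
gen 21; CES-discharge programme, stage 2, the part inside the route cone)

p3 gen 20's `…ManinConstantOfStevensInclusion` §3–§4 derived, modulo {modularity, CDT, CES, T-es-75}: `2 ∣ c₀ ⟹ 2⁵ ∣ N`, Abbes–Ullmo 1996 Thm A and
Česnavičius 2018 Thm 1.2 as corollaries, and the rung `ManinConstantOne` (`maninConstantOne_of_fourPrintedFacts`).  With the Stevens-curve theorem
(`StevensCurve.exists_optimal_gamma1ParametrizationData_one`, sibling `…StevensCurveDatum`) the CES binder is GONE: the same statements modulo
{modularity, CDT, T-es-75} — THREE statement-only printed facts (Diamond–Shurman 8.8.3, Calegari–Dimitrov–Tang Thm 1, Stevens 1982 Thm 1.3.1 (b)).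

* `two_pow_five_dvd_of_two_dvd_maninConstant_of_CDT_Tes75`, `abbesUllmo_of_CDT_Tes75`, `cesnavicius_of_CDT_Tes75`,
  `maninLocalTwoThree_abbesUllmoManinConstantGoodPrimes_of_CDT_Tes75` / `maninLocalTwoThree_cesnaviciusManinConstantAtTwo_of_CDT_Tes75` (items BY NAME);
* `cesWeak` — p2 gen 23's CES-weak binder (`…NaturalTes75OfOptimalTwin`) HOLDS, fact-free;
* `abs_maninConstant_eq_one_of_threePrintedFacts`, **`maninConstantOne_of_threePrintedFacts : exists_isNewformOf → CDT → T-es-75 → ManinConstantOne`**,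
  **`maninLocalTwoThree_maninConstantOneRung_of_threePrintedFacts`** (the rung target stmt-BirchSwinnertonDyer-22445 BY NAME, CONDITIONAL).

HONEST FRAMING: CONDITIONAL theorems; the three facts are undischarged hypotheses; Manin's conjecture, C2, C3 and BSD are NOT proved; the items stay OPEN.
[cite: CalegariDimitrovTang2025, Thm. 1] [cite: Stevens1982, §1.3 Thm. 1.3.1 (b)] [cite: AbbesUllmo1996, Thm. A] [cite: Cesnavicius2018, Thm. 1.2]
[cite: Manin1972, §1.6]
-/

set_option autoImplicit false
-- lint-debt: the directory name repeats the summit name (sibling precedent `ManinLocalTwoThreeManinConstantOfStevensInclusion.lean`)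
set_option linter.dupNamespace false

noncomputable section

open scoped Classical MatrixGroups
open Complex CongruenceSubgroup WeierstrassCurve
open Literature.NumberTheory.EllipticCurves Literature.NumberTheory.EllipticCurves.ModularForms
open Literature.NumberTheory.Automorphic

namespace Summit.BirchSwinnertonDyer.BirchSwinnertonDyer.Theorems.ManinLocalTwoThree.StevensCurve

/-! ## CES-weak (p2 gen 23's interface `…NaturalTes75OfOptimalTwin`) holds, fact-free -/

/-- **CES-weak HOLDS** — verbatim the binder `hCESw` of p2 gen 23's `NaturalTes75.optimalTwin_of_modularity_CESweak` /
`maninConstantOne_of_modularity_CDT_Tes75_CESweak` / `shimuraKernelCyclic_of_modularity_Tes75_CESweak`: every lattice-optimal `X₀(N)`-datum of a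
globally minimal curve has an OPTIMAL `X₁(N)`-twin with the same newform on some elliptic `E₁/ℚ` — by the Stevens-curve theorem
(`exists_optimal_gamma1ParametrizationData_one`; minimality of `W₀` is not even used).  So p2's `…_CESweak` rows hold with this term plugged in, and
`NaturalTes75.naturalTes75_of_modularity_CESweak_Tes75 hnf cesWeak hSt` is T-es-75♮ ⟸ {modularity, T-es-75}.  Fact-free. [cite: Stevens1989, §2]
[cite: ConradEdixhovenStein2003, §6.1] -/
theorem cesWeak : ∀ (W₀ : WeierstrassCurve ℚ) [W₀.IsElliptic] [W₀.IsGloballyMinimal] {N : ℕ} [NeZero N] (D₀ : ModularParametrizationData W₀ N),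
    (∀ z ∈ D₀.L.lattice, ∃ w ∈ periodLattice D₀.f, z = D₀.c * w) →
      ∃ (E₁ : WeierstrassCurve ℚ) (_ : E₁.IsElliptic) (D₁ : Gamma1ParametrizationData E₁ N), D₁.IsOptimal ∧ D₁.f = D₀.f := by
  intro W₀ _ _ N _ D₀ hopt
  obtain ⟨W₁, hW₁, D₁, hf, -, hD₁, -, -⟩ := exists_optimal_gamma1ParametrizationData_one D₀ hopt
  exact ⟨W₁, hW₁, D₁, hD₁, hf⟩

/-! ## The prime `2` modulo CDT ∧ T-es-75 and the rung `ManinConstantOne` modulo THREE printed facts -/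

/-- **`2 ∣ c₀ ⟹ 2⁵ ∣ N`, modulo CDT ∧ T-es-75** (Stevens' inclusion ⟸ CDT puts `2 ∣ c₀` in the half-index world; §1 + PROPOSITION A).  CONDITIONAL.
[cite: CalegariDimitrovTang2025, Thm. 1] [cite: Stevens1982, §1.3 Thm. 1.3.1 (b)] -/
theorem two_pow_five_dvd_of_two_dvd_maninConstant_of_CDT_Tes75 (hCDT : CalegariDimitrovTang2025_unboundedDenominators)
    (hSt : optimalGamma1Parametrization_cuspInv_galoisAction) (W₀ : WeierstrassCurve ℚ) [W₀.IsElliptic] [W₀.IsGloballyMinimal] {N : ℕ} [NeZero N]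
    (D₀ : ModularParametrizationData W₀ N) (hopt : ∀ z ∈ D₀.L.lattice, ∃ w ∈ periodLattice D₀.f, z = D₀.c * w)
    (h2 : (2 : ℤ) ∣ D₀.maninConstant) : 2 ^ 5 ∣ N := by
  have hhalf := KummerValues.halfIndex_of_gamma1Periods_le_of_two_dvd D₀ hopt (CDivisionInt.periodLatticeGamma1_le_neron_of_CDTInt hCDT D₀) h2
  exact KummerValues.two_pow_five_dvd_of_halfIndex_of_kummerValues W₀ D₀ hopt hhalf (halfIndex_kummerValues_of_Tes75 hSt W₀ D₀ hopt hhalf)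

/-- **Abbes–Ullmo 1996 Thm A (`p ∤ N ⟹ p ∤ c₀`) ⟸ CDT ∧ T-es-75** (odd `p`: `KummerValues.not_dvd_maninConstant_of_CDT`; `p = 2 ∤ N` against `2⁵ ∣ N`).
CONDITIONAL. [cite: AbbesUllmo1996, Thm. A] [cite: CalegariDimitrovTang2025, Thm. 1] [cite: Stevens1982, §1.3 Thm. 1.3.1 (b)] -/
theorem abbesUllmo_of_CDT_Tes75 (hCDT : CalegariDimitrovTang2025_unboundedDenominators) (hSt : optimalGamma1Parametrization_cuspInv_galoisAction) :
    abbesUllmo_not_dvd_maninConstant_of_not_dvd_level := by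
  intro W' _ _ N' _ D' hopt p hp hpN
  rcases hp.eq_two_or_odd' with rfl | hodd
  · intro h2
    exact hpN ((dvd_pow_self 2 (by norm_num)).trans
      (two_pow_five_dvd_of_two_dvd_maninConstant_of_CDT_Tes75 hCDT hSt W' D' hopt (by exact_mod_cast h2)))
  · obtain ⟨k, hk⟩ := hodd
    exact KummerValues.not_dvd_maninConstant_of_CDT hCDT W' D' hopt (by have := hp.two_le; omega)

/-- **Česnavičius 2018 Thm 1.2 (`2 ∥ N ⟹ 2 ∤ c₀`) ⟸ CDT ∧ T-es-75.** CONDITIONAL.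
[cite: Cesnavicius2018, Thm. 1.2] [cite: CalegariDimitrovTang2025, Thm. 1] [cite: Stevens1982, §1.3 Thm. 1.3.1 (b)] -/
theorem cesnavicius_of_CDT_Tes75 (hCDT : CalegariDimitrovTang2025_unboundedDenominators) (hSt : optimalGamma1Parametrization_cuspInv_galoisAction) :
    cesnavicius_not_two_dvd_maninConstant_of_two_dvd_level := by
  intro W' _ _ N' _ D' hopt _ h4 h2
  exact h4 ((pow_dvd_pow 2 (by norm_num : 2 ≤ 5)).trans (two_pow_five_dvd_of_two_dvd_maninConstant_of_CDT_Tes75 hCDT hSt W' D' hopt h2))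

/-- **The support item `AbbesUllmoManinConstantGoodPrimes` (stmt-BirchSwinnertonDyer-20090) BY NAME ⟸ CDT ∧ T-es-75.** CONDITIONAL. [cite: AbbesUllmo1996, Thm. A] -/
theorem maninLocalTwoThree_abbesUllmoManinConstantGoodPrimes_of_CDT_Tes75 (hCDT : CalegariDimitrovTang2025_unboundedDenominators)
    (hSt : optimalGamma1Parametrization_cuspInv_galoisAction) :
    Summit.BirchSwinnertonDyer.BirchSwinnertonDyer.Theses.ManinLocalTwoThree.AbbesUllmoManinConstantGoodPrimes :=
  abbesUllmo_of_CDT_Tes75 hCDT hSt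

/-- **The support item `CesnaviciusManinConstantAtTwo` (stmt-BirchSwinnertonDyer-20091) BY NAME ⟸ CDT ∧ T-es-75.** CONDITIONAL. [cite: Cesnavicius2018, Thm. 1.2] -/
theorem maninLocalTwoThree_cesnaviciusManinConstantAtTwo_of_CDT_Tes75 (hCDT : CalegariDimitrovTang2025_unboundedDenominators)
    (hSt : optimalGamma1Parametrization_cuspInv_galoisAction) :
    Summit.BirchSwinnertonDyer.BirchSwinnertonDyer.Theses.ManinLocalTwoThree.CesnaviciusManinConstantAtTwo :=
  cesnavicius_of_CDT_Tes75 hCDT hSt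

/-- **`|c₀| = 1` for every lattice-optimal `X₀(N)`-datum of every globally minimal curve, modulo {modularity, CDT, T-es-75}** (`|c₀| ≤ 2` by
Stevens' inclusion ⟸ CDT and conjugation; `|c₀| = 2` would be the half-index world, excluded by `not_halfIndex_of_modularity_Tes75`).  CES is no
longer needed; Mazur / Abbes–Ullmo / Česnavičius are not used.  CONDITIONAL; Manin's conjecture is NOT proved unconditionally; BSD is not proved.
[cite: CalegariDimitrovTang2025, Thm. 1] [cite: Stevens1982, §1.3 Thm. 1.3.1 (b)] [cite: Manin1972, §1.6] -/
theorem abs_maninConstant_eq_one_of_threePrintedFacts (hnf : exists_isNewformOf) (hCDT : CalegariDimitrovTang2025_unboundedDenominators)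
    (hSt : optimalGamma1Parametrization_cuspInv_galoisAction) (W₀ : WeierstrassCurve ℚ) [W₀.IsElliptic] [W₀.IsGloballyMinimal] {N : ℕ} [NeZero N]
    (D₀ : ModularParametrizationData W₀ N) (hopt : ∀ z ∈ D₀.L.lattice, ∃ w ∈ periodLattice D₀.f, z = D₀.c * w) :
    |D₀.maninConstant| = 1 := by
  have hSI := CDivisionInt.periodLatticeGamma1_le_neron_of_CDTInt hCDT D₀
  have hle := KummerValues.natAbs_maninConstant_le_two_of_gamma1Periods_le D₀ hopt hSI
  have hne : D₀.maninConstant ≠ 0 := D₀.maninConstant_ne_zero_holds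
  have hne2 : D₀.maninConstant.natAbs ≠ 2 := fun h2 ↦
    not_halfIndex_of_modularity_Tes75 hnf hSt W₀ D₀ hopt
      (KummerValues.halfIndex_of_gamma1Periods_le_of_two_dvd D₀ hopt hSI (Int.natAbs_dvd_natAbs.mp (by rw [h2]; decide)))
  have h1 : D₀.maninConstant.natAbs = 1 := by
    have h0 : D₀.maninConstant.natAbs ≠ 0 := Int.natAbs_ne_zero.mpr hne
    omega
  rw [Int.abs_eq_natAbs, h1, Nat.cast_one]

/-- **Manin's conjecture leaf `ManinConstantOne` ⟸ THREE printed facts {modularity, CDT, T-es-75}** (CES eliminated).  CONDITIONAL on three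
statement-only facts, none discharged; Manin's conjecture and BSD are NOT proved. [cite: CalegariDimitrovTang2025, Thm. 1] [cite: Stevens1982, §1.3 Thm. 1.3.1 (b)] -/
theorem maninConstantOne_of_threePrintedFacts (hnf : exists_isNewformOf) (hCDT : CalegariDimitrovTang2025_unboundedDenominators)
    (hSt : optimalGamma1Parametrization_cuspInv_galoisAction) :
    Summit.BirchSwinnertonDyer.Rank1Residual.ManinConstant.ManinConstantOne :=
  fun W₀ _ _ _ _ D₀ hopt ↦ abs_maninConstant_eq_one_of_threePrintedFacts hnf hCDT hSt W₀ D₀ hopt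

/-- **The route's rung target `ManinConstantOneRung` (stmt-BirchSwinnertonDyer-22445) BY NAME ⟸ {modularity, CDT, T-es-75}** — three printed facts
(CES eliminated).  CONDITIONAL; the item stays open as filed; BSD is not proved. [cite: CalegariDimitrovTang2025, Thm. 1] [cite: Stevens1982, §1.3 Thm. 1.3.1 (b)] -/
theorem maninLocalTwoThree_maninConstantOneRung_of_threePrintedFacts (hnf : exists_isNewformOf) (hCDT : CalegariDimitrovTang2025_unboundedDenominators)
    (hSt : optimalGamma1Parametrization_cuspInv_galoisAction) :
    Summit.BirchSwinnertonDyer.BirchSwinnertonDyer.Theses.ManinLocalTwoThree.ManinConstantOneRung :=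
  fun W₀ _ _ _ _ D₀ hopt ↦ abs_maninConstant_eq_one_of_threePrintedFacts hnf hCDT hSt W₀ D₀ hopt

end Summit.BirchSwinnertonDyer.BirchSwinnertonDyer.Theorems.ManinLocalTwoThree.StevensCurve

end
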